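import Mathlib
import Summits.Ventures.PercRepro.TriangleCapDeepRows
import Summits.Ventures.PercRepro.TriangleCapDeepThreeWitness

/-!
# PercRepro — THE REGULAR CELL `t = ℓ D`: THE DEEP SUB-BAND OF `K_{ℓ,D}` FOR EVERY `ℓ ≤ D` (p3, gen 54; part 287)

With `ℓ` non-neighbours of `w`, every off-degree `≤ D` and `t = ℓ D` off-edges (`ℓ ≤ D`), the non-neighbours are
FORCED: `Σ_{x ∈ L} c(x) = t + |inside| ≤ ℓ D = t` gives no inside edge and `c(x) = D` for every non-neighbour, and
the deficiency identity of part 279 becomes an EXACT formula for the band value through the rows alone: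

  **`2 j + 2 t (D − 1) = t (t − 1) + ℓ D (D − ℓ) + Σ_{y ∈ N(w)} k(y) (ℓ − k(y))`**   (`regular_cell_identity`)

— the excess over the bottom `C(t,2) − t (D − 1) + ℓ D (D − ℓ)/2` (the value of `K_{ℓ,D}`, `regular_cell_bottom`,
attained by `regularWitness`: the round robin over the `ℓ` non-neighbours with blocks of `ℓ` consecutive pairs
sharing a leaf) is HALF THE SUM OF `k (ℓ − k)` OVER THE ROWS, each partial row costing at least `ℓ − 1`.  Hence
`j ≠ bottom + 1` for `ℓ ≥ 4` (`regular_cell_not_bottom_succ`; `ℓ = 3` is part 281's mod-3 argument), and the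
attained values of the cell are exactly `bottom + ½ Σ k(y)(ℓ − k(y))` over the row-size multisets of the cell.
Axioms: standard.
-/

namespace PercRepro

namespace TriangleCap

namespace C047

open Finset

variable {V : Type*} [Fintype V] [DecidableEq V]

/-- **THE REGULAR CELL IS FORCED:** with `ℓ` non-neighbours, every off-degree `≤ D` and `t = ℓ D`: no inside edge
and every non-neighbour has off-degree `D`. -/
theorem regular_cell_forced (H : SimpleGraph V) [DecidableRel H.Adj] (hfree : H.CliqueFree 3) (w : V) (ℓ D : ℕ)
    (hℓ : (nonNbrs H w).card = ℓ) (ht : (offEdges H w).card = ℓ * D) (hD : ∀ v, offDeg H w v ≤ D) :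
    (insideEdges H w).card = 0 ∧ ∀ x ∈ nonNbrs H w, offDeg H w x = D := by
  have hsum := sum_offDeg_nonNbrs_eq H w
  have hatt := attach_add_card_inside H hfree w
  rw [ht] at hsum hatt
  have hle : ∑ x ∈ nonNbrs H w, offDeg H w x ≤ ∑ _x ∈ nonNbrs H w, D := sum_le_sum (fun x _ => hD x)
  rw [sum_const, hℓ, smul_eq_mul] at hle
  refine ⟨by omega, fun x hx => ?_⟩
  by_contra hne
  have hlt : offDeg H w x < D := lt_of_le_of_ne (hD x) hne
  have := sum_lt_sum (fun y _ => hD y) ⟨x, hx, hlt⟩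
  rw [sum_const, hℓ, smul_eq_mul] at this
  omega

/-- The row deficiency at `k ≤ ℓ ≤ D`: `k (D − k) = k (D − ℓ) + k (ℓ − k)`. -/
theorem row_deficiency_split (k ℓ D : ℕ) (hk : k ≤ ℓ) (hℓ : ℓ ≤ D) :
    k * (D - k) = k * (D - ℓ) + k * (ℓ - k) := by
  rw [← Nat.mul_add]
  congr 1
  omega

/-- **THE REGULAR CELL IDENTITY:** with `ℓ ≤ D` non-neighbours, every off-degree `≤ D` and `t = ℓ D`,
`2 j + 2 t (D − 1) = t (t − 1) + ℓ D (D − ℓ) + Σ_{y ∈ N(w)} k(y) (ℓ − k(y))`. -/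
theorem regular_cell_identity (H : SimpleGraph V) [DecidableRel H.Adj] (hfree : H.CliqueFree 3) (s t j ℓ D : ℕ)
    (hs : H.edgeFinset.card = s) (w : V) (hw : deg H w + t = s) (hw1 : 1 ≤ deg H w)
    (hj : ∑ v, deg H v * deg H v + 2 * (t * (s - t - 1)) + 2 * j = s * (s + 1))
    (hD : ∀ v, offDeg H w v ≤ D) (hℓ : (nonNbrs H w).card = ℓ) (hℓD : ℓ ≤ D) (ht : t = ℓ * D) :
    2 * j + 2 * (t * (D - 1)) =
      t * (t - 1) + ℓ * D * (D - ℓ) + ∑ y ∈ univ.filter (fun y => H.Adj w y), offDeg H w y * (ℓ - offDeg H w y) := by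
  have hid := deficiency_identity_split H hfree s t j D hs w hw hw1 hj hD
  have htE : (offEdges H w).card = t := by
    have := card_offEdges_add_deg H w
    omega
  obtain ⟨hI, hall⟩ := regular_cell_forced H hfree w ℓ D hℓ (by rw [htE, ht]) hD
  have hatt := attach_add_card_inside H hfree w
  rw [htE, hI, add_zero] at hatt
  have hL : ∑ x ∈ nonNbrs H w, offDeg H w x * (D - offDeg H w x) = 0 := by
    apply sum_eq_zero
    intro x hx
    rw [hall x hx]
    simp
  have hrows : ∑ y ∈ univ.filter (fun y => H.Adj w y), offDeg H w y * (D - offDeg H w y) =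
      (D - ℓ) * attach H w + ∑ y ∈ univ.filter (fun y => H.Adj w y), offDeg H w y * (ℓ - offDeg H w y) := by
    unfold attach
    rw [mul_sum, ← sum_add_distrib]
    apply sum_congr rfl
    intro y hy
    rw [mem_filter] at hy
    have hk := offDeg_le_card_nonNbrs_of_adj H hfree w y hy.2
    rw [hℓ] at hk
    rw [row_deficiency_split _ ℓ D hk hℓD, mul_comm (D - ℓ)]
  rw [hid, hI, hL, hrows, hatt, ht]
  have e : (D - ℓ) * (ℓ * D) = ℓ * D * (D - ℓ) := by ring
  rw [e]
  ring

/-- **THE BOTTOM OF THE REGULAR CELL:** `t (t − 1) + ℓ D (D − ℓ) ≤ 2 j + 2 t (D − 1)` — the value of `K_{ℓ,D}`. -/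
theorem regular_cell_bottom (H : SimpleGraph V) [DecidableRel H.Adj] (hfree : H.CliqueFree 3) (s t j ℓ D : ℕ)
    (hs : H.edgeFinset.card = s) (w : V) (hw : deg H w + t = s) (hw1 : 1 ≤ deg H w)
    (hj : ∑ v, deg H v * deg H v + 2 * (t * (s - t - 1)) + 2 * j = s * (s + 1))
    (hD : ∀ v, offDeg H w v ≤ D) (hℓ : (nonNbrs H w).card = ℓ) (hℓD : ℓ ≤ D) (ht : t = ℓ * D) :
    t * (t - 1) + ℓ * D * (D - ℓ) ≤ 2 * j + 2 * (t * (D - 1)) := by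
  have := regular_cell_identity H hfree s t j ℓ D hs w hw hw1 hj hD hℓ hℓD ht
  omega

/-- **THE RIGID BOTTOM FOR `ℓ ≥ 4`:** `2 j + 2 t (D − 1) ≠ t (t − 1) + ℓ D (D − ℓ) + 2` — a partial row costs at
least `ℓ − 1 ≥ 3`. -/
theorem regular_cell_not_bottom_succ (H : SimpleGraph V) [DecidableRel H.Adj] (hfree : H.CliqueFree 3)
    (s t j ℓ D : ℕ) (hs : H.edgeFinset.card = s) (w : V) (hw : deg H w + t = s) (hw1 : 1 ≤ deg H w)
    (hj : ∑ v, deg H v * deg H v + 2 * (t * (s - t - 1)) + 2 * j = s * (s + 1))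
    (hD : ∀ v, offDeg H w v ≤ D) (hℓ : (nonNbrs H w).card = ℓ) (hℓD : ℓ ≤ D) (ht : t = ℓ * D) (hℓ4 : 4 ≤ ℓ) :
    2 * j + 2 * (t * (D - 1)) ≠ t * (t - 1) + ℓ * D * (D - ℓ) + 2 := by
  have hid := regular_cell_identity H hfree s t j ℓ D hs w hw hw1 hj hD hℓ hℓD ht
  intro heq
  have hsum : ∑ y ∈ univ.filter (fun y => H.Adj w y), offDeg H w y * (ℓ - offDeg H w y) = 2 := by omega
  -- every term is `0` or at least `ℓ − 1 ≥ 3`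
  have hterm : ∀ y ∈ univ.filter (fun y => H.Adj w y),
      offDeg H w y * (ℓ - offDeg H w y) = 0 ∨ 3 ≤ offDeg H w y * (ℓ - offDeg H w y) := by
    intro y hy
    rw [mem_filter] at hy
    have hk := offDeg_le_card_nonNbrs_of_adj H hfree w y hy.2
    rw [hℓ] at hk
    obtain ⟨k, hkdef⟩ : ∃ k, offDeg H w y = k := ⟨_, rfl⟩
    rw [hkdef] at hk ⊢
    rcases Nat.eq_zero_or_pos k with rfl | hk0
    · left
      simp
    · rcases Nat.lt_or_ge k ℓ with hkl | hkl
      · right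
        have h1 : 1 ≤ ℓ - k := by omega
        have h2 : ℓ - 1 ≤ k * (ℓ - k) := by
          rcases Nat.lt_or_ge k 2 with hk1 | hk2
          · have : k = 1 := by omega
            subst this
            omega
          · -- `k (ℓ − k) ≥ 2 (ℓ − k) ≥ ℓ − 1` when `ℓ − k ≥ 1`, since `k ≥ 2`: `k(ℓ−k) − (ℓ−1) = (k−1)(ℓ−k−1) ≥ 0`
            have h3 : (k - 1) * (ℓ - k - 1) + (ℓ - 1) = k * (ℓ - k) := by
              obtain ⟨k', rfl⟩ : ∃ k', k = k' + 2 := ⟨k - 2, by omega⟩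
              obtain ⟨m, hm⟩ : ∃ m, ℓ = k' + 2 + 1 + m := ⟨ℓ - k' - 3, by omega⟩
              subst hm
              have e1 : k' + 2 - 1 = k' + 1 := by omega
              have e2 : k' + 2 + 1 + m - (k' + 2) - 1 = m := by omega
              have e3 : k' + 2 + 1 + m - 1 = k' + 2 + m := by omega
              have e4 : k' + 2 + 1 + m - (k' + 2) = m + 1 := by omega
              rw [e1, e2, e3, e4]
              ring
            omega
        omega
      · left
        have : ℓ - k = 0 := by omega
        rw [this, mul_zero]
  -- a sum of terms each `0` or `≥ 3` equals `2`: impossible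
  have hne : ∑ y ∈ univ.filter (fun y => H.Adj w y), offDeg H w y * (ℓ - offDeg H w y) ≠ 0 := by omega
  obtain ⟨y₀, hy₀, hne₀⟩ := exists_ne_zero_of_sum_ne_zero hne
  have h3 : 3 ≤ offDeg H w y₀ * (ℓ - offDeg H w y₀) := by
    rcases hterm y₀ hy₀ with h | h
    · exact absurd h hne₀
    · exact h
  have hle : offDeg H w y₀ * (ℓ - offDeg H w y₀) ≤
      ∑ y ∈ univ.filter (fun y => H.Adj w y), offDeg H w y * (ℓ - offDeg H w y) :=
    single_le_sum (f := fun y => offDeg H w y * (ℓ - offDeg H w y)) (fun y _ => Nat.zero_le _) hy₀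
  omega

/-! ### The witness `K_{ℓ,D}`: the round robin over the non-neighbours with blocks of `ℓ` pairs per leaf -/

/-- The right ends of `K_{ℓ,D}`: the pairs `ℓ b, …, ℓ b + ℓ − 1` share the leaf `ℓ + 1 + b`. -/
def rfBlock (ℓ i : ℕ) : ℕ := ℓ + 1 + i / ℓ

/-- The class of the leaf `ℓ + 1 + b` (`b < D`): exactly `ℓ` pairs. -/
theorem cls_rfBlock (ℓ D b : ℕ) (hℓ : 0 < ℓ) (hb : b < D) :
    ((range (ℓ * D)).filter (fun i => rfBlock ℓ i = ℓ + 1 + b)).card = ℓ := by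
  have hset : (range (ℓ * D)).filter (fun i => rfBlock ℓ i = ℓ + 1 + b) = Ico (ℓ * b) (ℓ * b + ℓ) := by
    ext i
    simp only [mem_filter, mem_range, mem_Ico]
    unfold rfBlock
    constructor
    · rintro ⟨hi, hv⟩
      obtain ⟨q, hq⟩ : ∃ q, i / ℓ = q := ⟨_, rfl⟩
      rw [hq] at hv
      have hdiv : i / ℓ = b := by omega
      rw [Nat.div_eq_iff hℓ, mul_comm b ℓ] at hdiv
      omega
    · rintro ⟨h1, h2⟩
      have hdiv : i / ℓ = b := by
        rw [Nat.div_eq_iff hℓ, mul_comm b ℓ]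
        omega
      have hbD : ℓ * (b + 1) ≤ ℓ * D := Nat.mul_le_mul_left ℓ hb
      rw [Nat.mul_succ] at hbD
      rw [hdiv]
      omega
  rw [hset, Nat.card_Ico]
  omega

/-- The bounds of `rfBlock`: `ℓ + 1 ≤ rfBlock i < ℓ + 1 + D` for `i < ℓ D`. -/
theorem rfBlock_bounds (ℓ D i : ℕ) (hℓ : 0 < ℓ) (hi : i < ℓ * D) :
    ℓ + 1 ≤ rfBlock ℓ i ∧ rfBlock ℓ i < ℓ + 1 + D := by
  unfold rfBlock
  have : i / ℓ < D := by
    rw [Nat.div_lt_iff_lt_mul hℓ, mul_comm D ℓ]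
    exact hi
  obtain ⟨q, hq⟩ : ∃ q, i / ℓ = q := ⟨_, rfl⟩
  rw [hq] at this ⊢
  omega

/-- The collision count of the blocks: `coll (ℓ D) (rfBlock ℓ) = D ℓ (ℓ − 1)`. -/
theorem coll_rfBlock (ℓ D : ℕ) (hℓ : 0 < ℓ) : coll (ℓ * D) (rfBlock ℓ) = D * (ℓ * (ℓ - 1)) := by
  rw [coll_eq_sum_cls (ℓ * D) (rfBlock ℓ) ((range D).image (fun b => ℓ + 1 + b)) (fun i hi => by
    rw [mem_image]
    have := rfBlock_bounds ℓ D i hℓ hi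
    exact ⟨rfBlock ℓ i - (ℓ + 1), mem_range.mpr (by omega), by omega⟩)]
  rw [sum_image (fun b _ b' _ h => by omega)]
  rw [sum_const_nat (m := ℓ * (ℓ - 1)) (fun b hb => by
    unfold cls
    rw [cls_rfBlock ℓ D b hℓ (mem_range.mp hb)]), card_range]

/-- The ends of `K_{ℓ,D}` are good (`1 ≤ ℓ`, `2 ℓ D ≤ s`). -/
theorem goodEnds_regular (s ℓ D : ℕ) (hℓ : 1 ≤ ℓ) (hs : 2 * (ℓ * D) ≤ s) :
    GoodEnds (ℓ + 1 + (s - ℓ * D)) (ℓ + 1) (ℓ * D) (lfRR ℓ 0) (rfBlock ℓ) := by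
  refine ⟨fun i _ => ?_, fun i hi => ?_, fun i i' hi hi' h1 h2 => ?_⟩
  · have := lfRR_bounds ℓ 0 i hℓ
    omega
  · have := rfBlock_bounds ℓ D i (by omega) hi
    have hDs : D ≤ s - ℓ * D := by
      have : D ≤ ℓ * D := Nat.le_mul_of_pos_left D (by omega)
      omega
    omega
  · unfold lfRR at h1
    rw [if_neg (by omega), if_neg (by omega)] at h1
    unfold rfBlock at h2
    have e1 := Nat.div_add_mod i ℓ
    have e2 := Nat.div_add_mod i' ℓ
    obtain ⟨q, hq⟩ : ∃ q, i / ℓ = q := ⟨_, rfl⟩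
    obtain ⟨q', hq'⟩ : ∃ q', i' / ℓ = q' := ⟨_, rfl⟩
    obtain ⟨m, hm⟩ : ∃ m, i % ℓ = m := ⟨_, rfl⟩
    obtain ⟨m', hm'⟩ : ∃ m', i' % ℓ = m' := ⟨_, rfl⟩
    rw [hq, hm] at e1
    rw [hq', hm'] at e2
    rw [hq, hq'] at h2
    rw [hm, hm'] at h1
    have hqq : q = q' := by omega
    have hmm : m = m' := by omega
    subst hqq hmm
    omega

/-- The classes of the round robin `lfRR ℓ 0` on `ℓ D` indices: `D` at every `1 ≤ v ≤ ℓ`, none elsewhere. -/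
theorem cls_lfRR_regular (ℓ D v : ℕ) (hℓ : 0 < ℓ) :
    ((range (ℓ * D)).filter (fun i => lfRR ℓ 0 i = v)).card = if 1 ≤ v ∧ v ≤ ℓ then D else 0 := by
  split_ifs with hv
  · obtain ⟨y, rfl⟩ : ∃ y, v = y + 1 := ⟨v - 1, by omega⟩
    have := cls_lfRR_zero ℓ (ℓ * D) y hℓ (by omega)
    unfold cls at this
    rw [this, Nat.mul_div_cancel_left D hℓ, Nat.mul_mod_right, if_neg (by omega), add_zero]
  · rw [card_eq_zero, filter_eq_empty_iff]
    intro i _ h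
    have := lfRR_bounds ℓ 0 i (by omega)
    omega

/-- **THE WITNESS `K_{ℓ,D}`:** for `1 ≤ ℓ ≤ D`, `t = ℓ D`, `2 t ≤ s`, a triangle-free graph on `ℓ + 1 + (s − t)`
vertices with `s` edges, a vertex `w` of degree `s − t`, every off-degree `≤ D`, a non-neighbour of off-degree `D`,
and the band value `2 j = t (t − 1) − ℓ D (D + ℓ − 2)`. -/
theorem regularWitness (s t ℓ D : ℕ) (hℓ : 1 ≤ ℓ) (hℓD : ℓ ≤ D) (ht : t = ℓ * D) (hs : 2 * t ≤ s) :
    ∃ (H : SimpleGraph (Fin (ℓ + 1 + (s - t)))) (_ : DecidableRel H.Adj), H.CliqueFree 3 ∧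
      H.edgeFinset.card = s ∧ ∃ w, deg H w + t = s ∧ (∀ v, offDeg H w v ≤ D) ∧
        (∃ x, ¬ H.Adj w x ∧ offDeg H w x = D) ∧
        ∑ v, deg H v * deg H v + 2 * (t * (s - t - 1)) + (t * (t - 1) - ℓ * D * (D + ℓ - 2)) = s * (s + 1) := by
  subst ht
  set t := ℓ * D with htdef
  set n := ℓ + 1 + (s - t) with hn
  have hn0 : 0 < n := by omega
  have hD1 : 1 ≤ D := by omega
  have ht1 : 1 ≤ t := Nat.one_le_iff_ne_zero.mpr (by positivity)
  have hg := goodEnds_regular s ℓ D hℓ hs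
  have hval := genWitness_missing_value n (ℓ + 1) s t hn0 (lfRR ℓ 0) (rfBlock ℓ) hg (by omega) ht1 (by omega)
    (by omega)
  have hatt : ((range t).filter (fun i => rfBlock ℓ i < ℓ + 1 + (s - t))).card = t := by
    rw [filter_true_of_mem (fun i hi => by
      rw [mem_range] at hi
      have := rfBlock_bounds ℓ D i (by omega) hi
      have hDs : D ≤ s - t := by
        have : D ≤ ℓ * D := Nat.le_mul_of_pos_left D (by omega)
        omega
      omega), card_range]
  have hcl : coll t (lfRR ℓ 0) = ℓ * (D * (D - 1)) := by
    rw [htdef, coll_lfRR_zero ℓ (ℓ * D) (by omega), Nat.mul_div_cancel_left D (by omega), Nat.mul_mod_right,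
      zero_mul, mul_zero, add_zero]
  have hcr : coll t (rfBlock ℓ) = D * (ℓ * (ℓ - 1)) := coll_rfBlock ℓ D (by omega)
  rw [hatt, hcl, hcr, Nat.sub_self, mul_zero, zero_add] at hval
  have hDs : D ≤ s - t := by
    have : D ≤ ℓ * D := Nat.le_mul_of_pos_left D (by omega)
    omega
  refine ⟨_, inferInstance, cliqueFree_of_bipSub _ _ (bipSub_missingGraph _ _),
    card_edges_missingGraph_genWitness n (ℓ + 1) s t hn0 (lfRR ℓ 0) (rfBlock ℓ) hg (by omega) (by omega)
      (by omega), fin' n hn0 0, ?_, ?_, ?_, ?_⟩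
  · rw [deg_missingGraph_genWitness_zero n (ℓ + 1) s t hn0 (lfRR ℓ 0) (rfBlock ℓ) hg (by omega) (by omega)]
    omega
  · intro v
    have hv : v = fin' n hn0 v.val := Fin.ext (by rw [fin'_val n hn0 v.val v.isLt])
    rw [hv]
    by_cases hva : v.val < ℓ + 1
    · rw [offDeg_genWitness_left n (ℓ + 1) s t hn0 (lfRR ℓ 0) (rfBlock ℓ) hg (by omega) v.val hva, htdef,
        cls_lfRR_regular ℓ D v.val (by omega)]
      split_ifs <;> omega
    · rw [offDeg_genWitness_right n (ℓ + 1) s t hn0 (lfRR ℓ 0) (rfBlock ℓ) hg (by omega) v.val (by omega) v.isLt]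
      by_cases hvb : v.val < ℓ + 1 + D
      · obtain ⟨b, hb⟩ : ∃ b, v.val = ℓ + 1 + b := ⟨v.val - (ℓ + 1), by omega⟩
        rw [hb, htdef, cls_rfBlock ℓ D b (by omega) (by omega)]
        exact hℓD
      · rw [card_eq_zero.mpr (filter_eq_empty_iff.mpr (fun i hi hv' => by
          rw [mem_range] at hi
          have := rfBlock_bounds ℓ D i (by omega) hi
          omega))]
        omega
  · refine ⟨fin' n hn0 1, not_adj_genWitness_one n (ℓ + 1) s t hn0 (lfRR ℓ 0) (rfBlock ℓ) (by omega) (by omega),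
      ?_⟩
    rw [offDeg_genWitness_left n (ℓ + 1) s t hn0 (lfRR ℓ 0) (rfBlock ℓ) hg (by omega) 1 (by omega), htdef,
      cls_lfRR_regular ℓ D 1 (by omega), if_pos ⟨le_rfl, hℓ⟩]
  · have e : ℓ * (D * (D - 1)) + D * (ℓ * (ℓ - 1)) = ℓ * D * (D + ℓ - 2) := by
      obtain ⟨D', rfl⟩ : ∃ D', D = D' + 1 := ⟨D - 1, by omega⟩
      obtain ⟨ℓ', rfl⟩ : ∃ ℓ', ℓ = ℓ' + 1 := ⟨ℓ - 1, by omega⟩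
      have e1 : D' + 1 - 1 = D' := by omega
      have e2 : ℓ' + 1 - 1 = ℓ' := by omega
      have e3 : D' + 1 + (ℓ' + 1) - 2 = D' + ℓ' := by omega
      rw [e1, e2, e3]
      ring
    rw [e] at hval
    exact hval

/-- **THE BOTTOM OF THE REGULAR CELL IS ATTAINED:** `2 j = t (t − 1) + ℓ D (D − ℓ) − 2 t (D − 1)` is the band
value of `K_{ℓ,D}` (`1 ≤ ℓ ≤ D`, `t = ℓ D`). -/
theorem regular_bottom_value (ℓ D : ℕ) (hℓ : 1 ≤ ℓ) (hℓD : ℓ ≤ D) :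
    ℓ * D * (ℓ * D - 1) - ℓ * D * (D + ℓ - 2) + 2 * (ℓ * D * (D - 1)) = ℓ * D * (ℓ * D - 1) + ℓ * D * (D - ℓ) := by
  obtain ⟨D', rfl⟩ : ∃ D', D = D' + 1 := ⟨D - 1, by omega⟩
  obtain ⟨ℓ', rfl⟩ : ∃ ℓ', ℓ = ℓ' + 1 := ⟨ℓ - 1, by omega⟩
  have e1 : D' + 1 - 1 = D' := by omega
  have e3 : D' + 1 + (ℓ' + 1) - 2 = D' + ℓ' := by omega
  have e4 : D' + 1 - (ℓ' + 1) = D' - ℓ' := by omega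
  rw [e1, e3, e4]
  have hle : ℓ' ≤ D' := by omega
  obtain ⟨m, rfl⟩ : ∃ m, D' = ℓ' + m := ⟨D' - ℓ', by omega⟩
  have e5 : ℓ' + m - ℓ' = m := by omega
  rw [e5]
  have e6 : (ℓ' + 1) * (ℓ' + m + 1) - 1 = ℓ' * (ℓ' + m + 1) + ℓ' + m := by
    have : (ℓ' + 1) * (ℓ' + m + 1) = ℓ' * (ℓ' + m + 1) + ℓ' + m + 1 := by ring
    omega
  rw [e6]
  have e7 : (ℓ' + 1) * (ℓ' + m + 1) * (ℓ' * (ℓ' + m + 1) + ℓ' + m) =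
      (ℓ' + 1) * (ℓ' + m + 1) * (ℓ' + m + ℓ') + (ℓ' + 1) * (ℓ' + m + 1) * (ℓ' * (ℓ' + m + 1) + ℓ' + m - (ℓ' + m + ℓ')) := by
    rw [← Nat.mul_add, Nat.add_sub_cancel' (by nlinarith)]
  rw [e7, Nat.add_sub_cancel_left]
  have e8 : ℓ' * (ℓ' + m + 1) + ℓ' + m - (ℓ' + m + ℓ') = ℓ' * (ℓ' + m + 1) - ℓ' := by omega
  rw [e8]
  have e9 : ℓ' * (ℓ' + m + 1) - ℓ' = ℓ' * (ℓ' + m) := by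
    have : ℓ' * (ℓ' + m + 1) = ℓ' * (ℓ' + m) + ℓ' := by ring
    omega
  rw [e9]
  ring

end C047

end TriangleCap

end PercRepro
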